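import Literature.Topology.FourManifolds.TrisectionsCentralSurfaceLocal
import Mathlib.Analysis.Calculus.ContDiff.RCLike
import HarnessLib

/-!
# First-order structure of a Gay–Kirby trisection along the central surface: the transition
# between the linear charts of two adjacent sectors

Topic `Literature/Topology/FourManifolds`; infrastructure for the fact seat
`provefact-Literature.Topology.FourManifolds.exists-14560f9fc8` (named fact (c′)
`Literature.Topology.FourManifolds.exists_stabilized_gkTrisection`), continuing
`TrisectionsCentralSurfaceLocal.lean`.  Everything in this file is **proved**; no definitions,
no named facts.

`TrisectionsCentralSurfaceLocal.lean` shows that near a point `x` of the central surface `F` each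
sector `S i` of a Gay–Kirby trisection is, in a smooth chart `cᵢ = Aᵢ⁻¹ ∘ ψᵢ` of `X`, the linear
`2`-sector `Q × ℝ²` (`Q` the closed quadrant of the normal `(q₀, q₁)`-plane), with `F` the
stratum `{q₀ = q₁ = 0}` and the two open faces lying one in each of the other two sectors.  The
charts `cᵢ`, `cⱼ` of two sectors are unrelated, and the third face `S j ∩ S l` is *curved* in the
chart of `S i`.  This file computes what the corner structure forces **to first order**: for the
transition map `σ = cᵢ ∘ cⱼ⁻¹` at a stratum point `p` (a local diffeomorphism of `ℝ⁴` with
derivative `L`), normalised so that the common face `S i ∩ S j` is `{q₀ = 0 ≤ q₁}` in `cᵢ` and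
`{z₀ = 0 ≤ z₁}` in `cⱼ`,

* `L` preserves the stratum plane `{w₀ = w₁ = 0}` (`σ` maps stratum to stratum);
* `L e₁ ≡ λ e₁` modulo the stratum plane with `λ > 0` (`σ` maps the common face into itself);
* the normal part `ν = ((L e₀)₀, (L e₀)₁)` of the image of the generator `e₀` of the *other*
  face of `S j` — the tangent ray at `p` of the third face `S j ∩ S l` read in the chart of
  `S i` — has **`ν₀ < 0`**: the open sector `{z₀ > 0, z₁ > 0}` of `S j` misses `S i = {q ∈ Q}`,
  so `L(s e₁ + t e₀) = (t ν₀, s λ + t ν₁, …)` lies in the closed cone `{w₀ ≤ 0} ∪ {w₁ ≤ 0}` for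
  all `s, t > 0`, whence `ν₀ ≤ 0`, and `ν₀ ≠ 0` by invertibility of `L`
  (`firstOrder_of_cornerTransition`).

Applied to both neighbours `j₀`, `j₁` of `S i` and combined with the uniqueness of the tangent ray
of the third face (strict differentiability of the transition maps), this gives the rigid normal
picture at every point of `F`: **the third face leaves `F` into the open third quadrant of the
chart of `S i`** (`ν₀ < 0` and `ν₁ < 0`) — the input for straightening it, i.e. for a joint chart
in which all three sectors are linear (Gay–Kirby's "`F × (three sectors)`", Def. 1 and Fig. 1).

## Contents

* Cone limits of difference quotients (`mem_of_tendsto_smul_of_cone`,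
  `tendsto_smul_sub_of_hasFDerivAt`).
* First-order analysis of a map `σ : ℝ⁴ → ℝ⁴` at a stratum point (`apply_stratum_of_hasFDerivAt`,
  `stratum_of_apply_stratum`, `apply_single_of_face`, `apply_mem_cone_of_openSector`,
  `firstOrder_of_cornerTransition`).
* The third face through its two sectors: chain rule and positivity
  (`normal_apply_eq_smul_of_comp`, `normal_apply_neg_of_comp`); the first-order data of the
  inverse transition (`firstOrder_inverse`).
* Swapping the two normal coordinates of a linear chart (`linearChart_clauses_swap`), a linear
  chart with a prescribed neighbour across the first face
  (`IsGKTrisection.exists_linearChart_face`).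
* The transition between two linear charts of `X`: values, smoothness, eventual behaviour,
  the derivative and its inverse (`transition_apply_chart`, `contDiffAt_transition`,
  `eventually_transition`, `fderiv_transition_comp_eq_id`, `injective_fderiv_transition`).
* `firstOrder_of_linearCharts` (the three hypotheses on `σ` read off the chart clauses) and the
  packaging theorem `IsGKTrisection.exists_linearCharts_thirdFace`.

## References

* D. Gay, R. Kirby, *Trisecting 4-manifolds*, Geom. Topol. 20 (2016) 3097–3132
  (arXiv:1205.1565): Def. 1 and Fig. 1. [GayKirby2016]
* A. Douady, *Variétés à bord anguleux et voisinages tubulaires*, Séminaire H. Cartan 14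
  (1961/62), exp. 1, §1 (tangent sectors of a manifold with corners are well defined).
  [Douady1961]
* M. W. Hirsch, *Differential Topology* (1976), §1.4. [Hirsch1976]
-/

open scoped Manifold ContDiff Topology
open Set Function Filter

noncomputable section

namespace Literature.Topology.FourManifolds

universe u

/-! ### Cone limits of difference quotients -/

section ConeLimit

variable {E : Type*} [NormedAddCommGroup E] [NormedSpace ℝ E]

/-- **Closed cones are closed under limits of difference quotients.**  If `g t` lies in a closed
cone `K` for all small `t > 0` and `t⁻¹ • g t → w` as `t → 0⁺`, then `w ∈ K`. [folklore] -/
theorem mem_of_tendsto_smul_of_cone {K : Set E} (hK : IsClosed K)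
    (hcone : ∀ t : ℝ, 0 < t → ∀ k ∈ K, t • k ∈ K) {g : ℝ → E} {w : E}
    (hg : ∀ᶠ t in 𝓝[>] (0:ℝ), g t ∈ K)
    (hlim : Tendsto (fun t => t⁻¹ • g t) (𝓝[>] 0) (𝓝 w)) : w ∈ K := by
  refine hK.mem_of_tendsto hlim ?_
  filter_upwards [hg, self_mem_nhdsWithin] with t ht htpos
  exact hcone _ (inv_pos.mpr htpos) _ ht

variable {E' : Type*} [NormedAddCommGroup E'] [NormedSpace ℝ E']

/-- The difference quotient along a line converges to the derivative:
`t⁻¹ • (σ (p + t • v) - σ p) → L v` as `t → 0⁺`. [folklore] -/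
theorem tendsto_smul_sub_of_hasFDerivAt {σ : E → E'} {L : E →L[ℝ] E'} {p : E}
    (hσ : HasFDerivAt σ L p) (v : E) :
    Tendsto (fun t : ℝ => t⁻¹ • (σ (p + t • v) - σ p)) (𝓝[>] 0) (𝓝 (L v)) := by
  have hc : Tendsto (fun t : ℝ => ‖t⁻¹‖) (𝓝[>] 0) atTop := by
    refine tendsto_inv_nhdsGT_zero.congr' ?_
    filter_upwards [self_mem_nhdsWithin] with t ht
    rw [Real.norm_eq_abs, abs_inv, abs_of_pos (mem_Ioi.mp ht)]
  refine (hσ.lim v hc).congr' ?_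
  filter_upwards with t
  simp [inv_inv]

end ConeLimit

/-! ### First-order analysis of the transition between two corner charts -/

section FirstOrder

/-- The stratum plane `{w₀ = w₁ = 0}` of `ℝ⁴` as a submodule. [folklore] -/
private theorem mem_stratumSubmodule_iff (w : EuclideanSpace ℝ (Fin 4)) :
    w ∈ (LinearMap.ker
          (EuclideanSpace.proj (0 : Fin 4) : EuclideanSpace ℝ (Fin 4) →L[ℝ] ℝ).toLinearMap ⊓
        LinearMap.ker
          (EuclideanSpace.proj (1 : Fin 4) : EuclideanSpace ℝ (Fin 4) →L[ℝ] ℝ).toLinearMap :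
        Submodule ℝ (EuclideanSpace ℝ (Fin 4))) ↔ w 0 = 0 ∧ w 1 = 0 := by
  simp [Submodule.mem_inf, LinearMap.mem_ker]

/-- **A linear automorphism of `ℝ⁴` preserving the stratum plane `{w₀ = w₁ = 0}` preserves it
exactly**: if `L w` is on the plane then so is `w` (injective endomorphisms of a
finite-dimensional space are surjective). [folklore] -/
theorem stratum_of_apply_stratum {L : EuclideanSpace ℝ (Fin 4) →L[ℝ] EuclideanSpace ℝ (Fin 4)}
    (hLinj : Injective L)
    (hL : ∀ w : EuclideanSpace ℝ (Fin 4), w 0 = 0 → w 1 = 0 → L w 0 = 0 ∧ L w 1 = 0)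
    {w : EuclideanSpace ℝ (Fin 4)} (h0 : L w 0 = 0) (h1 : L w 1 = 0) : w 0 = 0 ∧ w 1 = 0 := by
  set V : Submodule ℝ (EuclideanSpace ℝ (Fin 4)) :=
    LinearMap.ker (EuclideanSpace.proj (0 : Fin 4) : EuclideanSpace ℝ (Fin 4) →L[ℝ] ℝ).toLinearMap ⊓
      LinearMap.ker
        (EuclideanSpace.proj (1 : Fin 4) : EuclideanSpace ℝ (Fin 4) →L[ℝ] ℝ).toLinearMap with hV
  have hmem : ∀ u : EuclideanSpace ℝ (Fin 4), u ∈ V ↔ u 0 = 0 ∧ u 1 = 0 :=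
    mem_stratumSubmodule_iff
  have hmaps : ∀ u ∈ V, (L : EuclideanSpace ℝ (Fin 4) →ₗ[ℝ] EuclideanSpace ℝ (Fin 4)) u ∈ V := by
    intro u hu
    rw [hmem] at hu ⊢
    exact hL u hu.1 hu.2
  set Lr := (L : EuclideanSpace ℝ (Fin 4) →ₗ[ℝ] EuclideanSpace ℝ (Fin 4)).restrict hmaps with hLr
  have hinj : Injective Lr := by
    intro u u' huu'
    apply Subtype.ext
    apply hLinj
    have := congrArg Subtype.val huu'
    simpa [hLr] using this
  have hsurj : Surjective Lr := LinearMap.injective_iff_surjective.mp hinj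
  have hLw : L w ∈ V := (hmem _).2 ⟨h0, h1⟩
  obtain ⟨v, hv⟩ := hsurj ⟨L w, hLw⟩
  have hv' : L v = L w := by
    have := congrArg Subtype.val hv
    simpa [hLr] using this
  have : (v : EuclideanSpace ℝ (Fin 4)) = w := hLinj hv'
  rw [← this]
  exact (hmem _).1 v.2

variable {σ : EuclideanSpace ℝ (Fin 4) → EuclideanSpace ℝ (Fin 4)}
  {L : EuclideanSpace ℝ (Fin 4) →L[ℝ] EuclideanSpace ℝ (Fin 4)} {p : EuclideanSpace ℝ (Fin 4)}

/-- Along the line `t ↦ p + t v` the points stay in the domain of an `eventually` hypothesis.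
[folklore] -/
private theorem eventually_line {P : EuclideanSpace ℝ (Fin 4) → Prop} (hP : ∀ᶠ z in 𝓝 p, P z)
    (v : EuclideanSpace ℝ (Fin 4)) : ∀ᶠ t in 𝓝[>] (0:ℝ), P (p + t • v) := by
  have hc : Tendsto (fun t : ℝ => p + t • v) (𝓝 0) (𝓝 p) := by
    have : Continuous fun t : ℝ => p + t • v := by fun_prop
    simpa using this.tendsto 0
  exact (hc.eventually hP).filter_mono nhdsWithin_le_nhds

/-- **The derivative of a stratum-preserving map preserves the stratum plane.**  If `σ` maps the
points of the plane `{z₀ = z₁ = 0}` near `p` (a point of the plane) into the plane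
`{w_a = w_b = 0}`, then so does its derivative `L` at `p`. [cite: Douady1961, §1] -/
theorem apply_stratum_of_hasFDerivAt {a b : Fin 4} (hσ : HasFDerivAt σ L p)
    (hp : p 0 = 0 ∧ p 1 = 0)
    (hstr : ∀ᶠ z in 𝓝 p, (z 0 = 0 ∧ z 1 = 0) → (σ z a = 0 ∧ σ z b = 0))
    {w : EuclideanSpace ℝ (Fin 4)} (hw0 : w 0 = 0) (hw1 : w 1 = 0) :
    L w a = 0 ∧ L w b = 0 := by
  have hσp : σ p a = 0 ∧ σ p b = 0 := hstr.self_of_nhds hp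
  have hK : IsClosed {q : EuclideanSpace ℝ (Fin 4) | q a = 0 ∧ q b = 0} :=
    (isClosed_eq (EuclideanSpace.proj a).continuous continuous_const).inter
      (isClosed_eq (EuclideanSpace.proj b).continuous continuous_const)
  refine mem_of_tendsto_smul_of_cone (K := {q | q a = 0 ∧ q b = 0}) hK ?_ ?_
    (tendsto_smul_sub_of_hasFDerivAt hσ w)
  · rintro t - k ⟨hka, hkb⟩
    simp [hka, hkb]
  · filter_upwards [eventually_line hstr w] with t ht
    have hz : (p + t • w) 0 = 0 ∧ (p + t • w) 1 = 0 := by simp [hp.1, hp.2, hw0, hw1]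
    obtain ⟨ha, hb⟩ := ht hz
    simp [ha, hb, hσp.1, hσp.2]

/-- **The derivative maps a face into a face.**  If `σ` maps the face `{z_c = 0 ≤ z_d}` near
the point `p` (with `p_c = p_d = 0`) into the closed face-cone `{w_a = 0 ≤ w_b}`, and `σ p` has
`a`- and `b`-components `0`, then `(L e_d)_a = 0` and `(L e_d)_b ≥ 0`. [cite: Douady1961, §1] -/
theorem apply_single_of_face {a b c d : Fin 4} (hcd : c ≠ d) (hσ : HasFDerivAt σ L p)
    (hp : p c = 0 ∧ p d = 0) (hσp : σ p a = 0 ∧ σ p b = 0)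
    (hface : ∀ᶠ z in 𝓝 p, (z c = 0 ∧ 0 ≤ z d) → (σ z a = 0 ∧ 0 ≤ σ z b)) :
    L (EuclideanSpace.single d 1) a = 0 ∧ 0 ≤ L (EuclideanSpace.single d 1) b := by
  have hK : IsClosed {q : EuclideanSpace ℝ (Fin 4) | q a = 0 ∧ 0 ≤ q b} :=
    (isClosed_eq (EuclideanSpace.proj a).continuous continuous_const).inter
      (isClosed_le continuous_const (EuclideanSpace.proj b).continuous)
  refine mem_of_tendsto_smul_of_cone (K := {q | q a = 0 ∧ 0 ≤ q b}) hK ?_ ?_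
    (tendsto_smul_sub_of_hasFDerivAt hσ _)
  · rintro t ht k ⟨hka, hkb⟩
    refine ⟨by simp [hka], ?_⟩
    simpa using mul_nonneg ht.le hkb
  · filter_upwards [eventually_line hface (EuclideanSpace.single d 1), self_mem_nhdsWithin]
      with t ht htpos
    have hz : (p + t • EuclideanSpace.single d (1:ℝ)) c = 0 ∧
        0 ≤ (p + t • EuclideanSpace.single d (1:ℝ)) d := by
      constructor
      · simp [hp.1, hcd]
      · simp [hp.2, le_of_lt (mem_Ioi.mp htpos)]
    obtain ⟨ha, hb⟩ := ht hz
    refine ⟨by simp [ha, hσp.1], ?_⟩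
    simp [hσp.2, hb]

/-- **The derivative maps the common face into the common face.**  If `σ` maps the face
`{z₀ = 0 ≤ z₁}` near the stratum point `p` into `{w_a = 0 ≤ w_b}` (and `p` to the stratum), then
`(L e₁)_a = 0` and `(L e₁)_b ≥ 0`. [cite: Douady1961, §1] -/
theorem apply_single_one_of_face {a b : Fin 4} (hσ : HasFDerivAt σ L p)
    (hp : p 0 = 0 ∧ p 1 = 0) (hσp : σ p a = 0 ∧ σ p b = 0)
    (hface : ∀ᶠ z in 𝓝 p, (z 0 = 0 ∧ 0 ≤ z 1) → (σ z a = 0 ∧ 0 ≤ σ z b)) :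
    L (EuclideanSpace.single 1 1) a = 0 ∧ 0 ≤ L (EuclideanSpace.single 1 1) b :=
  apply_single_of_face (c := 0) (d := 1) (by decide) hσ hp hσp hface

/-- **The derivative maps the open sector of `S j` off the sector of `S i`.**  If `σ` maps the
open sector `{z₀ > 0, z₁ > 0}` near the stratum point `p` into the complement of the quadrant
`{w_a ≥ 0, w_b ≥ 0}` (and `p` to the stratum), then for all `s, t > 0` the vector
`L (s e₁ + t e₀)` lies in the closed cone `{w_a ≤ 0} ∪ {w_b ≤ 0}`. [cite: Douady1961, §1] -/
theorem apply_mem_cone_of_openSector {a b : Fin 4} (hσ : HasFDerivAt σ L p)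
    (hp : p 0 = 0 ∧ p 1 = 0) (hσp : σ p a = 0 ∧ σ p b = 0)
    (hopen : ∀ᶠ z in 𝓝 p, (0 < z 0 ∧ 0 < z 1) → ¬ (0 ≤ σ z a ∧ 0 ≤ σ z b))
    {s t : ℝ} (hs : 0 < s) (ht : 0 < t) :
    L (s • EuclideanSpace.single 1 1 + t • EuclideanSpace.single 0 1) a ≤ 0 ∨
      L (s • EuclideanSpace.single 1 1 + t • EuclideanSpace.single 0 1) b ≤ 0 := by
  have hK : IsClosed {q : EuclideanSpace ℝ (Fin 4) | q a ≤ 0 ∨ q b ≤ 0} :=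
    (isClosed_le (EuclideanSpace.proj a).continuous continuous_const).union
      (isClosed_le (EuclideanSpace.proj b).continuous continuous_const)
  refine mem_of_tendsto_smul_of_cone (K := {q | q a ≤ 0 ∨ q b ≤ 0}) hK ?_ ?_
    (tendsto_smul_sub_of_hasFDerivAt hσ _)
  · rintro r hr k (hk | hk)
    · left; simpa using mul_nonpos_of_nonneg_of_nonpos hr.le hk
    · right; simpa using mul_nonpos_of_nonneg_of_nonpos hr.le hk
  · filter_upwards [eventually_line hopen (s • EuclideanSpace.single 1 1 +
      t • EuclideanSpace.single 0 1), self_mem_nhdsWithin] with r hr hrpos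
    have hr' : 0 < r := mem_Ioi.mp hrpos
    have hz : 0 < (p + r • (s • EuclideanSpace.single (1 : Fin 4) (1:ℝ) +
        t • EuclideanSpace.single (0 : Fin 4) (1:ℝ))) 0 ∧
        0 < (p + r • (s • EuclideanSpace.single (1 : Fin 4) (1:ℝ) +
        t • EuclideanSpace.single (0 : Fin 4) (1:ℝ))) 1 := by
      constructor
      · simp [hp.1]; positivity
      · simp [hp.2]; positivity
    have hnot := hr hz
    simp only [PiLp.sub_apply, hσp.1, hσp.2, sub_zero]
    by_contra hcon
    push Not at hcon
    exact hnot ⟨hcon.1.le, hcon.2.le⟩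

/-- **First-order structure of the transition between the linear charts of two adjacent
sectors at a point of the central surface.**  Let `σ` (the transition `cᵢ ∘ cⱼ⁻¹` between the
linear charts of sectors `S j` and `S i`, `TrisectionsCentralSurfaceLocal.lean`) be differentiable
at a stratum point `p` with injective derivative `L`, map stratum points to stratum points, the
face `{z₀ = 0 ≤ z₁}` (the common face `S i ∩ S j` in the chart of `S j`) into the face
`{w_a = 0 ≤ w_b}` (the same face in the chart of `S i`), and the open sector `{z₀, z₁ > 0}` of
`S j` off the sector `{w_a, w_b ≥ 0}` of `S i`.  Then `L` preserves the stratum plane,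
`L e₁ ≡ λ e₁` with `λ = (L e₁)_b > 0`, and the image of the generator `e₀` of the other face of
`S j` — the tangent ray of the third face `S j ∩ S l` in the chart of `S i` — has
**negative `a`-component**: `(L e₀)_a < 0`. [cite: GayKirby2016, Def. 1 and Fig. 1]
[cite: Douady1961, §1] -/
theorem firstOrder_of_cornerTransition {a b : Fin 4} (hab : (a = 0 ∧ b = 1) ∨ (a = 1 ∧ b = 0))
    (hσ : HasFDerivAt σ L p) (hLinj : Injective L) (hp : p 0 = 0 ∧ p 1 = 0)
    (hstr : ∀ᶠ z in 𝓝 p, (z 0 = 0 ∧ z 1 = 0) → (σ z a = 0 ∧ σ z b = 0))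
    (hface : ∀ᶠ z in 𝓝 p, (z 0 = 0 ∧ 0 ≤ z 1) → (σ z a = 0 ∧ 0 ≤ σ z b))
    (hopen : ∀ᶠ z in 𝓝 p, (0 < z 0 ∧ 0 < z 1) → ¬ (0 ≤ σ z a ∧ 0 ≤ σ z b)) :
    (∀ w : EuclideanSpace ℝ (Fin 4), w 0 = 0 → w 1 = 0 → L w 0 = 0 ∧ L w 1 = 0) ∧
      L (EuclideanSpace.single 1 1) a = 0 ∧ 0 < L (EuclideanSpace.single 1 1) b ∧
      L (EuclideanSpace.single 0 1) a < 0 := by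
  have hσp : σ p a = 0 ∧ σ p b = 0 := hstr.self_of_nhds hp
  -- stratum invariance, in the coordinates `0, 1`
  have hstr' : ∀ w : EuclideanSpace ℝ (Fin 4), w 0 = 0 → w 1 = 0 → L w 0 = 0 ∧ L w 1 = 0 := by
    intro w hw0 hw1
    have h := apply_stratum_of_hasFDerivAt hσ hp hstr hw0 hw1
    rcases hab with ⟨rfl, rfl⟩ | ⟨rfl, rfl⟩
    · exact h
    · exact ⟨h.2, h.1⟩
  have hstr_ab : ∀ w : EuclideanSpace ℝ (Fin 4), L w a = 0 → L w b = 0 → w 0 = 0 ∧ w 1 = 0 := by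
    intro w ha hb
    refine stratum_of_apply_stratum hLinj hstr' ?_ ?_
    · rcases hab with ⟨rfl, rfl⟩ | ⟨rfl, rfl⟩
      exacts [ha, hb]
    · rcases hab with ⟨rfl, rfl⟩ | ⟨rfl, rfl⟩
      exacts [hb, ha]
  obtain ⟨h1a, h1b⟩ := apply_single_one_of_face hσ hp hσp hface
  set lam := L (EuclideanSpace.single 1 1) b with hlam
  set ν0 := L (EuclideanSpace.single 0 1) a with hν0
  set ν1 := L (EuclideanSpace.single 0 1) b with hν1
  -- `λ > 0`
  have hlam_pos : 0 < lam := by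
    rcases h1b.lt_or_eq with h | h
    · exact h
    · exfalso
      have := (hstr_ab (EuclideanSpace.single 1 1) h1a h.symm).2
      simp at this
  -- components of `L (s e₁ + t e₀)`
  have hcomp : ∀ s t : ℝ, ∀ c : Fin 4,
      L (s • EuclideanSpace.single 1 1 + t • EuclideanSpace.single 0 1) c =
        s * L (EuclideanSpace.single 1 1) c + t * L (EuclideanSpace.single 0 1) c := by
    intro s t c
    simp only [map_add, map_smul, PiLp.add_apply, PiLp.smul_apply, smul_eq_mul]
  -- `ν₀ ≤ 0`
  have hν0_le : ν0 ≤ 0 := by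
    have hs : 0 < (|ν1| + 1) / lam := by positivity
    rcases apply_mem_cone_of_openSector hσ hp hσp hopen hs one_pos with h | h
    · rw [hcomp, h1a] at h
      simpa using h
    · exfalso
      rw [hcomp] at h
      have : (|ν1| + 1) / lam * lam + 1 * ν1 = |ν1| + 1 + ν1 := by
        field_simp
      rw [this] at h
      have habs : -ν1 ≤ |ν1| := neg_le_abs ν1
      linarith
  -- `ν₀ ≠ 0`
  have hν0_ne : ν0 ≠ 0 := by
    intro h0
    -- `w = λ e₀ - ν₁ e₁` would be mapped into the stratum plane
    have hw := hstr_ab (lam • EuclideanSpace.single 0 1 - ν1 • EuclideanSpace.single 1 1)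
      (by
        simp only [map_sub, map_smul, PiLp.sub_apply, PiLp.smul_apply, smul_eq_mul]
        rw [← hν0, h0, h1a]; ring)
      (by
        simp only [map_sub, map_smul, PiLp.sub_apply, PiLp.smul_apply, smul_eq_mul]
        rw [← hν1, ← hlam]; ring)
    have : lam = 0 := by simpa using hw.1
    exact absurd this hlam_pos.ne'
  exact ⟨hstr', h1a, hlam_pos, lt_of_le_of_ne hν0_le hν0_ne⟩

end FirstOrder

/-! ### Comparing the third face through the charts of its two sectors -/

section ThirdFace

variable {σ' σ'' τ : EuclideanSpace ℝ (Fin 4) → EuclideanSpace ℝ (Fin 4)}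
  {L' L'' M : EuclideanSpace ℝ (Fin 4) →L[ℝ] EuclideanSpace ℝ (Fin 4)}
  {p : EuclideanSpace ℝ (Fin 4)}

/-- **The tangent ray of the third face is the same through both of its sectors.**  Let
`σ' = cᵢ ∘ c_{j₀}⁻¹` and `σ'' = cᵢ ∘ c_{j₁}⁻¹` be the transitions from the linear charts of the
two neighbours `S j₀`, `S j₁` of `S i` to the chart of `S i`, and `τ = c_{j₁} ∘ c_{j₀}⁻¹`, so that
`σ' = σ'' ∘ τ` near the stratum point `p`.  If `τ` maps the third face `{z₁ = 0 ≤ z₀}` (the face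
`S j₀ ∩ S j₁` in the chart of `S j₀`) into `{z₁ = 0 ≤ z₀}` (the same face in the chart of
`S j₁`) and `L''` preserves the stratum plane, then the normal parts of `L' e₀` and `L'' e₀` —
the tangent ray of the third face computed through `S j₀` and through `S j₁` — are *positively
proportional*: `((L' e₀)₀, (L' e₀)₁) = ω₀ • ((L'' e₀)₀, (L'' e₀)₁)` with `ω₀ = (M e₀)₀ ≥ 0`.
[cite: GayKirby2016, Def. 1 and Fig. 1] [cite: Douady1961, §1] -/
theorem normal_apply_eq_smul_of_comp (hτ : HasFDerivAt τ M p) (hσ'' : HasFDerivAt σ'' L'' (τ p))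
    (hσ' : HasFDerivAt σ' L' p) (hcomp : σ' =ᶠ[𝓝 p] σ'' ∘ τ)
    (hp : p 0 = 0 ∧ p 1 = 0) (hτp : τ p 0 = 0 ∧ τ p 1 = 0)
    (hT : ∀ᶠ z in 𝓝 p, (z 1 = 0 ∧ 0 ≤ z 0) → (τ z 1 = 0 ∧ 0 ≤ τ z 0))
    (hstr'' : ∀ w : EuclideanSpace ℝ (Fin 4), w 0 = 0 → w 1 = 0 → L'' w 0 = 0 ∧ L'' w 1 = 0) :
    0 ≤ M (EuclideanSpace.single 0 1) 0 ∧
      L' (EuclideanSpace.single 0 1) 0 =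
        M (EuclideanSpace.single 0 1) 0 * L'' (EuclideanSpace.single 0 1) 0 ∧
      L' (EuclideanSpace.single 0 1) 1 =
        M (EuclideanSpace.single 0 1) 0 * L'' (EuclideanSpace.single 0 1) 1 := by
  -- chain rule: `L' = L'' ∘ M`
  have hchain : HasFDerivAt σ' (L''.comp M) p :=
    (hσ''.comp p hτ).congr_of_eventuallyEq hcomp
  have hL' : L' = L''.comp M := hσ'.unique hchain
  -- `ω = M e₀` lies in the face `{z₁ = 0 ≤ z₀}`
  obtain ⟨hω1, hω0⟩ := apply_single_of_face (a := 1) (b := 0) (c := 1) (d := 0) (by decide) hτ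
    ⟨hp.2, hp.1⟩ ⟨hτp.2, hτp.1⟩ hT
  set om := M (EuclideanSpace.single 0 1) with hom
  -- decompose `ω = ω₀ e₀ + (stratum part)`
  have hdec : om = om 0 • EuclideanSpace.single 0 1 + (om - om 0 • EuclideanSpace.single 0 1) := by
    abel
  have hrest0 : (om - om 0 • EuclideanSpace.single (0 : Fin 4) (1:ℝ)) 0 = 0 := by simp
  have hrest1 : (om - om 0 • EuclideanSpace.single (0 : Fin 4) (1:ℝ)) 1 = 0 := by simp [hω1]
  obtain ⟨hs0, hs1⟩ := hstr'' _ hrest0 hrest1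
  refine ⟨hω0, ?_, ?_⟩
  · rw [hL', ContinuousLinearMap.comp_apply, ← hom]
    conv_lhs => rw [hdec]
    rw [map_add, map_smul, PiLp.add_apply, PiLp.smul_apply, hs0, smul_eq_mul, add_zero]
  · rw [hL', ContinuousLinearMap.comp_apply, ← hom]
    conv_lhs => rw [hdec]
    rw [map_add, map_smul, PiLp.add_apply, PiLp.smul_apply, hs1, smul_eq_mul, add_zero]

/-- **The third face leaves the central surface into the open third quadrant of the chart of
`S i`.**  In the situation of `normal_apply_eq_smul_of_comp`, if the tangent ray of the third
face has negative first component through `S j₀` (`(L' e₀)₀ < 0`,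
`firstOrder_of_cornerTransition` for the pair `(i, j₀)`, whose common face is `{q₀ = 0}`) and
negative second component through `S j₁` (`(L'' e₀)₁ < 0`, the same for `(i, j₁)`, common face
`{q₁ = 0}`), then through `S j₀` **both** components are negative.
[cite: GayKirby2016, Def. 1 and Fig. 1] -/
theorem normal_apply_neg_of_comp (hτ : HasFDerivAt τ M p) (hσ'' : HasFDerivAt σ'' L'' (τ p))
    (hσ' : HasFDerivAt σ' L' p) (hcomp : σ' =ᶠ[𝓝 p] σ'' ∘ τ)
    (hp : p 0 = 0 ∧ p 1 = 0) (hτp : τ p 0 = 0 ∧ τ p 1 = 0)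
    (hT : ∀ᶠ z in 𝓝 p, (z 1 = 0 ∧ 0 ≤ z 0) → (τ z 1 = 0 ∧ 0 ≤ τ z 0))
    (hstr'' : ∀ w : EuclideanSpace ℝ (Fin 4), w 0 = 0 → w 1 = 0 → L'' w 0 = 0 ∧ L'' w 1 = 0)
    (hν'0 : L' (EuclideanSpace.single 0 1) 0 < 0) (hν''1 : L'' (EuclideanSpace.single 0 1) 1 < 0) :
    L' (EuclideanSpace.single 0 1) 0 < 0 ∧ L' (EuclideanSpace.single 0 1) 1 < 0 := by
  obtain ⟨hω0, h0, h1⟩ := normal_apply_eq_smul_of_comp hτ hσ'' hσ' hcomp hp hτp hT hstr''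
  have hωpos : 0 < M (EuclideanSpace.single 0 1) 0 := by
    rcases hω0.lt_or_eq with h | h
    · exact h
    · exfalso
      rw [← h, zero_mul] at h0
      exact (lt_irrefl 0) (h0 ▸ hν'0)
  refine ⟨hν'0, ?_⟩
  rw [h1]
  exact mul_neg_of_pos_of_neg hωpos hν''1

end ThirdFace

/-! ### First-order data of the inverse transition -/

section Inverse

/-- **First-order data of the inverse transition `ρ = c' ∘ c⁻¹`.**  If `M ∘ L = id` and `L` has
the first-order data of `IsGKTrisection.exists_linearCharts_thirdFace` (stratum plane
preserved, `(L e₁)₀ = 0 < (L e₁)₁`, `(L e₀)₀ < 0`, `(L e₀)₁ < 0`), then `M` preserves the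
stratum plane, `(M e₁)₀ = 0 < (M e₁)₁`, `(M e₀)₀ < 0` and `(M e₀)₁ < 0`: in the chart of `S i`
the functions `η = (ρ ·)₀` and `ζ = (ρ ·)₁` (whose zero sets continue the common face and the
third face) have normal gradients `(∂₀η, ∂₁η) = ((M e₀)₀, 0)` and
`(∂₀ζ, ∂₁ζ) = ((M e₀)₁, (M e₁)₁)` of the stated signs at the stratum. [folklore] -/
theorem firstOrder_inverse {L M : EuclideanSpace ℝ (Fin 4) →L[ℝ] EuclideanSpace ℝ (Fin 4)}
    (hML : M.comp L = ContinuousLinearMap.id ℝ _)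
    (hstr : ∀ w : EuclideanSpace ℝ (Fin 4), w 0 = 0 → w 1 = 0 → L w 0 = 0 ∧ L w 1 = 0)
    (he1_0 : L (EuclideanSpace.single 1 1) 0 = 0) (he1_1 : 0 < L (EuclideanSpace.single 1 1) 1)
    (hν0 : L (EuclideanSpace.single 0 1) 0 < 0) (hν1 : L (EuclideanSpace.single 0 1) 1 < 0) :
    (∀ w : EuclideanSpace ℝ (Fin 4), w 0 = 0 → w 1 = 0 → M w 0 = 0 ∧ M w 1 = 0) ∧
      M (EuclideanSpace.single 1 1) 0 = 0 ∧ 0 < M (EuclideanSpace.single 1 1) 1 ∧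
      M (EuclideanSpace.single 0 1) 0 < 0 ∧ M (EuclideanSpace.single 0 1) 1 < 0 := by
  have hMLapply : ∀ v, M (L v) = v := fun v => by
    have := congrArg (fun T : EuclideanSpace ℝ (Fin 4) →L[ℝ] EuclideanSpace ℝ (Fin 4) => T v) hML
    simpa using this
  have hLinj : Injective L := LeftInverse.injective hMLapply
  -- `L` is also surjective, hence `L ∘ M = id`
  have hLsurj : Surjective L :=
    (LinearMap.injective_iff_surjective (f := (L : EuclideanSpace ℝ (Fin 4) →ₗ[ℝ]
      EuclideanSpace ℝ (Fin 4)))).mp hLinj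
  have hLMapply : ∀ v, L (M v) = v := fun v => by
    obtain ⟨w, rfl⟩ := hLsurj v
    rw [hMLapply]
  -- `M` preserves the stratum plane
  have hMstr : ∀ w : EuclideanSpace ℝ (Fin 4), w 0 = 0 → w 1 = 0 → M w 0 = 0 ∧ M w 1 = 0 := by
    intro w hw0 hw1
    refine stratum_of_apply_stratum hLinj hstr ?_ ?_ <;> rw [hLMapply]
    exacts [hw0, hw1]
  set lam := L (EuclideanSpace.single 1 1) 1 with hlam
  set ν0 := L (EuclideanSpace.single 0 1) 0 with hν0def
  set ν1 := L (EuclideanSpace.single 0 1) 1 with hν1def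
  -- `L e₁ = λ e₁ + s` with `s` on the stratum plane
  set s : EuclideanSpace ℝ (Fin 4) := L (EuclideanSpace.single 1 1) -
    lam • EuclideanSpace.single 1 1 with hs
  have hs0 : s 0 = 0 := by simp [hs, he1_0]
  have hs1 : s 1 = 0 := by simp [hs, hlam]
  obtain ⟨hMs0, hMs1⟩ := hMstr s hs0 hs1
  have hMe1 : M (EuclideanSpace.single 1 1) =
      lam⁻¹ • (EuclideanSpace.single 1 1 - M s) := by
    have h1 : EuclideanSpace.single (1 : Fin 4) (1:ℝ) =
        lam • M (EuclideanSpace.single 1 1) + M s := by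
      conv_lhs => rw [← hMLapply (EuclideanSpace.single 1 1)]
      have : L (EuclideanSpace.single 1 1) = lam • EuclideanSpace.single 1 1 + s := by
        rw [hs]; abel
      rw [this, map_add, map_smul]
    have hlam0 : lam ≠ 0 := he1_1.ne'
    have h2 : lam • M (EuclideanSpace.single 1 1) = EuclideanSpace.single 1 1 - M s :=
      eq_sub_iff_add_eq.mpr h1.symm
    calc M (EuclideanSpace.single 1 1)
        = lam⁻¹ • (lam • M (EuclideanSpace.single 1 1)) := by
          rw [smul_smul, inv_mul_cancel₀ hlam0, one_smul]
      _ = lam⁻¹ • (EuclideanSpace.single 1 1 - M s) := by rw [h2]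
  have e10 : (EuclideanSpace.single (1 : Fin 4) (1:ℝ)) 0 = 0 := by simp
  have e11 : (EuclideanSpace.single (1 : Fin 4) (1:ℝ)) 1 = 1 := by simp
  have hMe1_0 : M (EuclideanSpace.single 1 1) 0 = 0 := by
    rw [hMe1]
    simp only [PiLp.smul_apply, PiLp.sub_apply, smul_eq_mul, hMs0, e10]
    ring
  have hMe1_1 : M (EuclideanSpace.single 1 1) 1 = lam⁻¹ := by
    rw [hMe1]
    simp only [PiLp.smul_apply, PiLp.sub_apply, smul_eq_mul, hMs1, e11]
    ring
  -- `L e₀ = ν₀ e₀ + ν₁ e₁ + s'` with `s'` on the stratum plane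
  set s' : EuclideanSpace ℝ (Fin 4) := L (EuclideanSpace.single 0 1) -
    ν0 • EuclideanSpace.single 0 1 - ν1 • EuclideanSpace.single 1 1 with hs'
  have hs'0 : s' 0 = 0 := by simp [hs', hν0def]
  have hs'1 : s' 1 = 0 := by simp [hs', hν1def]
  obtain ⟨hMs'0, hMs'1⟩ := hMstr s' hs'0 hs'1
  have hMe0 : M (EuclideanSpace.single 0 1) = ν0⁻¹ • (EuclideanSpace.single 0 1 -
      ν1 • M (EuclideanSpace.single 1 1) - M s') := by
    have h1 : EuclideanSpace.single (0 : Fin 4) (1:ℝ) =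
        ν0 • M (EuclideanSpace.single 0 1) + ν1 • M (EuclideanSpace.single 1 1) + M s' := by
      conv_lhs => rw [← hMLapply (EuclideanSpace.single 0 1)]
      have : L (EuclideanSpace.single 0 1) =
          ν0 • EuclideanSpace.single 0 1 + ν1 • EuclideanSpace.single 1 1 + s' := by
        rw [hs']; abel
      rw [this, map_add, map_add, map_smul, map_smul]
    have hν00 : ν0 ≠ 0 := hν0.ne
    have h2 : ν0 • M (EuclideanSpace.single 0 1) =
        EuclideanSpace.single 0 1 - ν1 • M (EuclideanSpace.single 1 1) - M s' := by
      have h3 : ν0 • M (EuclideanSpace.single 0 1) + ν1 • M (EuclideanSpace.single 1 1) + M s' =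
          EuclideanSpace.single 0 1 := h1.symm
      have h4 := eq_sub_of_add_eq h3
      have h5 := eq_sub_of_add_eq h4
      rw [h5, sub_right_comm]
    calc M (EuclideanSpace.single 0 1)
        = ν0⁻¹ • (ν0 • M (EuclideanSpace.single 0 1)) := by
          rw [smul_smul, inv_mul_cancel₀ hν00, one_smul]
      _ = _ := by rw [h2]
  have e00 : (EuclideanSpace.single (0 : Fin 4) (1:ℝ)) 0 = 1 := by simp
  have e01 : (EuclideanSpace.single (0 : Fin 4) (1:ℝ)) 1 = 0 := by simp
  have hMe0_0 : M (EuclideanSpace.single 0 1) 0 = ν0⁻¹ := by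
    rw [hMe0]
    simp only [PiLp.smul_apply, PiLp.sub_apply, smul_eq_mul, hMe1_0, hMs'0, e00]
    ring
  have hMe0_1 : M (EuclideanSpace.single 0 1) 1 = -(ν0⁻¹ * (ν1 * lam⁻¹)) := by
    rw [hMe0]
    simp only [PiLp.smul_apply, PiLp.sub_apply, smul_eq_mul, hMe1_1, hMs'1, e01]
    ring
  refine ⟨hMstr, hMe1_0, by rw [hMe1_1]; exact inv_pos.mpr he1_1,
    by rw [hMe0_0]; exact inv_lt_zero.mpr hν0, ?_⟩
  rw [hMe0_1, neg_lt_zero]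
  exact mul_pos_of_neg_of_neg (inv_lt_zero.mpr hν0) (mul_neg_of_neg_of_pos hν1 (inv_pos.mpr he1_1))

end Inverse


/-! ### Swapping the two normal coordinates of a linear chart -/

section Swap

variable {X : Type u} [TopologicalSpace X] {S : Fin 3 → Set X} {i j l : Fin 3}
  {ψ : OpenPartialHomeomorph X (EuclideanSpace ℝ (Fin 4))}
  {A : EuclideanSpace ℝ (Fin 4) ≃L[ℝ] EuclideanSpace ℝ (Fin 4)} {O : Set X}

/-- The coordinate swap `q₀ ↔ q₁` of `ℝ⁴` composed into the linear part of a chart exchanges the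
two normal coordinates: `((swap ∘ A)⁻¹ w)_k = (A⁻¹ w)_{swap k}`. [folklore] -/
theorem swap_trans_symm_apply (A : EuclideanSpace ℝ (Fin 4) ≃L[ℝ] EuclideanSpace ℝ (Fin 4))
    (w : EuclideanSpace ℝ (Fin 4)) (k : Fin 4) :
    ((LinearIsometryEquiv.piLpCongrLeft 2 ℝ ℝ
        (Equiv.swap (0 : Fin 4) 1)).toContinuousLinearEquiv.trans A).symm w k =
      A.symm w (Equiv.swap (0 : Fin 4) 1 k) := by
  rw [ContinuousLinearEquiv.symm_trans_apply]
  simp [LinearIsometryEquiv.piLpCongrLeft_apply, Equiv.piCongrLeft']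

/-- **The clauses of a linear chart of a sector are symmetric in the two normal coordinates.**
Replacing the linear part `A` by `swap ∘ A` keeps "`S i` is the quadrant", "`F` is the stratum"
and "the other sectors are the complement of the open quadrant", and exchanges the two face
clauses. [cite: GayKirby2016, Def. 1 and Fig. 1] -/
theorem linearChart_clauses_swap
    (hS : ∀ y ∈ O, y ∈ S i ↔ A.symm (ψ y) ∈ cornerQuadrant)
    (hF : ∀ y ∈ O, y ∈ (⋂ m, S m) ↔
      A.symm (ψ y) ∈ cornerQuadrant ∧ A.symm (ψ y) 0 = 0 ∧ A.symm (ψ y) 1 = 0)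
    (hO : ∀ y ∈ O, (∃ m, m ≠ i ∧ y ∈ S m) ↔ ¬ (0 < A.symm (ψ y) 0 ∧ 0 < A.symm (ψ y) 1))
    (hf0 : ∀ y ∈ O, A.symm (ψ y) 0 = 0 → 0 < A.symm (ψ y) 1 → y ∈ S j)
    (hf1 : ∀ y ∈ O, A.symm (ψ y) 1 = 0 → 0 < A.symm (ψ y) 0 → y ∈ S l) :
    let A' := (LinearIsometryEquiv.piLpCongrLeft 2 ℝ ℝ
        (Equiv.swap (0 : Fin 4) 1)).toContinuousLinearEquiv.trans A
    (∀ y ∈ O, y ∈ S i ↔ A'.symm (ψ y) ∈ cornerQuadrant) ∧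
    (∀ y ∈ O, y ∈ (⋂ m, S m) ↔
      A'.symm (ψ y) ∈ cornerQuadrant ∧ A'.symm (ψ y) 0 = 0 ∧ A'.symm (ψ y) 1 = 0) ∧
    (∀ y ∈ O, (∃ m, m ≠ i ∧ y ∈ S m) ↔ ¬ (0 < A'.symm (ψ y) 0 ∧ 0 < A'.symm (ψ y) 1)) ∧
    (∀ y ∈ O, A'.symm (ψ y) 0 = 0 → 0 < A'.symm (ψ y) 1 → y ∈ S l) ∧
    (∀ y ∈ O, A'.symm (ψ y) 1 = 0 → 0 < A'.symm (ψ y) 0 → y ∈ S j) := by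
  intro A'
  have hk : ∀ y (k : Fin 4), A'.symm (ψ y) k = A.symm (ψ y) (Equiv.swap (0 : Fin 4) 1 k) :=
    fun y k => swap_trans_symm_apply A (ψ y) k
  have h0 : ∀ y, A'.symm (ψ y) 0 = A.symm (ψ y) 1 := fun y => by
    rw [hk]; simp
  have h1 : ∀ y, A'.symm (ψ y) 1 = A.symm (ψ y) 0 := fun y => by
    rw [hk]; simp [Equiv.swap_apply_right]
  have hQ : ∀ y, A'.symm (ψ y) ∈ cornerQuadrant ↔ A.symm (ψ y) ∈ cornerQuadrant := fun y => by
    simp only [cornerQuadrant, mem_setOf_eq, h0, h1]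
    exact and_comm
  refine ⟨fun y hy => (hS y hy).trans (hQ y).symm, fun y hy => ?_, fun y hy => ?_,
    fun y hy h0' h1' => ?_, fun y hy h1' h0' => ?_⟩
  · rw [hF y hy, hQ, h0, h1]
    exact ⟨fun h => ⟨h.1, h.2.2, h.2.1⟩, fun h => ⟨h.1, h.2.2, h.2.1⟩⟩
  · rw [hO y hy, h0, h1, and_comm]
  · rw [h0] at h0'; rw [h1] at h1'
    exact hf1 y hy h0' h1'
  · rw [h1] at h1'; rw [h0] at h0'
    exact hf0 y hy h1' h0'

end Swap

section PrescribedFace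

variable {X : Type u} [TopologicalSpace X] [T2Space X] [ChartedSpace (EuclideanSpace ℝ (Fin 4)) X]
  {g : ℕ} {k : Fin 3 → ℕ} {S : Fin 3 → Set X}

/-- **Linear chart of a sector with a prescribed neighbour across the first face.**  For a
Gay–Kirby trisection, a sector `S i`, a different sector `S j` and `x ∈ F`, there is a linear
chart of `S i` at `x` (`IsGKTrisection.exists_linearChart_faces`, possibly with its two normal
coordinates swapped) whose open face `{q₀ = 0 < q₁}` lies in `S j` and whose open face
`{q₁ = 0 < q₀}` lies in the third sector `S l`. [cite: GayKirby2016, Def. 1 and Fig. 1] -/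
theorem IsGKTrisection.exists_linearChart_face (h : IsGKTrisection X g k S) {i j : Fin 3}
    (hji : j ≠ i) {x : X} (hx : x ∈ ⋂ l, S l) :
    ∃ (ψ : OpenPartialHomeomorph X (EuclideanSpace ℝ (Fin 4)))
      (A : EuclideanSpace ℝ (Fin 4) ≃L[ℝ] EuclideanSpace ℝ (Fin 4)) (O : Set X) (l : Fin 3),
      ψ ∈ IsManifold.maximalAtlas (𝓡 4) ∞ X ∧ IsOpen O ∧ x ∈ O ∧ O ⊆ ψ.source ∧ ψ x = 0 ∧
      (∀ y ∈ O, y ∈ S i ↔ A.symm (ψ y) ∈ cornerQuadrant) ∧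
      (∀ y ∈ O, y ∈ (⋂ m, S m) ↔
        A.symm (ψ y) ∈ cornerQuadrant ∧ A.symm (ψ y) 0 = 0 ∧ A.symm (ψ y) 1 = 0) ∧
      (∀ y ∈ O, (∃ m, m ≠ i ∧ y ∈ S m) ↔ ¬ (0 < A.symm (ψ y) 0 ∧ 0 < A.symm (ψ y) 1)) ∧
      l ≠ i ∧ l ≠ j ∧
      (∀ y ∈ O, A.symm (ψ y) 0 = 0 → 0 < A.symm (ψ y) 1 → y ∈ S j) ∧
      (∀ y ∈ O, A.symm (ψ y) 1 = 0 → 0 < A.symm (ψ y) 0 → y ∈ S l) := by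
  obtain ⟨ψ, A, O, j₀, j₁, hψ, hO, hxO, hOψ, hψ0, hS, hF, hoth, hj₀, hj₁, hjj, hf0, hf1⟩ :=
    h.exists_linearChart_faces i hx
  by_cases hj : j₀ = j
  · subst hj
    exact ⟨ψ, A, O, j₁, hψ, hO, hxO, hOψ, hψ0, hS, hF, hoth, hj₁, fun h => hjj h.symm, hf0, hf1⟩
  · -- then `j₁ = j`: swap the two normal coordinates
    have hj1 : j₁ = j := by
      have hcard : ∀ i j j₀ j₁ : Fin 3,
          j = i ∨ j₀ = i ∨ j₁ = i ∨ j₀ = j₁ ∨ j₀ = j ∨ j₁ = j := by decide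
      rcases hcard i j j₀ j₁ with h' | h' | h' | h' | h' | h'
      exacts [absurd h' hji, absurd h' hj₀, absurd h' hj₁, absurd h' hjj, absurd h' hj, h']
    subst hj1
    obtain ⟨hS', hF', hoth', hf0', hf1'⟩ := linearChart_clauses_swap hS hF hoth hf0 hf1
    refine ⟨ψ, (LinearIsometryEquiv.piLpCongrLeft 2 ℝ ℝ
        (Equiv.swap (0 : Fin 4) 1)).toContinuousLinearEquiv.trans A, O, j₀, hψ, hO, hxO, hOψ,
      hψ0, hS', hF', hoth', hj₀, hjj, hf0', hf1'⟩

end PrescribedFace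

/-! ### The transition between two linear charts: smoothness, points, derivative -/

section Transition

variable {X : Type u} [TopologicalSpace X] [ChartedSpace (EuclideanSpace ℝ (Fin 4)) X]
  {ψ ψ' : OpenPartialHomeomorph X (EuclideanSpace ℝ (Fin 4))}
  {A A' : EuclideanSpace ℝ (Fin 4) ≃L[ℝ] EuclideanSpace ℝ (Fin 4)}

omit [ChartedSpace (EuclideanSpace ℝ (Fin 4)) X] in
/-- The transition `σ = (A⁻¹ ∘ ψ) ∘ (A'⁻¹ ∘ ψ')⁻¹` takes the `c'`-coordinates of a point to its
`c`-coordinates. [folklore] -/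
theorem transition_apply_chart {y : X} (hy : y ∈ ψ'.source) :
    (fun z => A.symm (ψ (ψ'.symm (A' z)))) (A'.symm (ψ' y)) = A.symm (ψ y) := by
  simp only [ContinuousLinearEquiv.apply_symm_apply, ψ'.left_inv hy]

/-- **The transition between two charts of the maximal `C^∞` atlas, conjugated by linear
automorphisms, is `C^∞`** at the coordinates of every point of the common domain. [folklore] -/
theorem contDiffAt_transition (hψ : ψ ∈ IsManifold.maximalAtlas (𝓡 4) ∞ X)
    (hψ' : ψ' ∈ IsManifold.maximalAtlas (𝓡 4) ∞ X) {y : X} (hy : y ∈ ψ.source)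
    (hy' : y ∈ ψ'.source) :
    ContDiffAt ℝ ∞ (fun z => A.symm (ψ (ψ'.symm (A' z)))) (A'.symm (ψ' y)) := by
  have hcc : ContDiffAt ℝ ∞ ((𝓡 4).extendCoordChange ψ' ψ) (ψ' y) := by
    have := (𝓡 4).contDiffWithinAt_extendCoordChange' (n := ∞) hψ' hψ hy' hy
    rwa [ModelWithCorners.range_eq_univ, contDiffWithinAt_univ, extend_self_apply] at this
  have hcc' : ContDiffAt ℝ ∞ (fun w => ψ (ψ'.symm w)) (ψ' y) := by
    refine hcc.congr_of_eventuallyEq (Filter.Eventually.of_forall fun w => ?_)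
    show ψ (ψ'.symm w) = ψ.extend (𝓡 4) ((ψ'.extend (𝓡 4)).symm w)
    rw [extend_self_symm_apply, extend_self_apply]
  have h1 : ContDiffAt ℝ ∞ (fun z => ψ (ψ'.symm (A' z))) (A'.symm (ψ' y)) := by
    have hA : ContDiffAt ℝ ∞ (fun z => A' z) (A'.symm (ψ' y)) := A'.contDiff.contDiffAt
    have hcc'' : ContDiffAt ℝ ∞ (fun w => ψ (ψ'.symm w)) (A' (A'.symm (ψ' y))) := by
      rwa [ContinuousLinearEquiv.apply_symm_apply]
    exact hcc''.comp _ hA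
  exact A.symm.contDiff.contDiffAt.comp _ h1

omit [ChartedSpace (EuclideanSpace ℝ (Fin 4)) X] in
/-- Points near the `c'`-coordinates of `y` are the `c'`-coordinates of points near `y`: for
`U ∈ 𝓝 y`, eventually (in `z`) the point `ψ'⁻¹(A' z)` lies in `U` and has `c'`-coordinates `z`.
[folklore] -/
theorem eventually_transition {y : X} (hy' : y ∈ ψ'.source) {U : Set X} (hU : U ∈ 𝓝 y) :
    ∀ᶠ z in 𝓝 (A'.symm (ψ' y)),
      ψ'.symm (A' z) ∈ U ∧ A'.symm (ψ' (ψ'.symm (A' z))) = z := by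
  have hc : ContinuousAt (fun z => ψ'.symm (A' z)) (A'.symm (ψ' y)) := by
    refine ContinuousAt.comp (g := ψ'.symm) ?_ A'.continuous.continuousAt
    rw [ContinuousLinearEquiv.apply_symm_apply]
    exact ψ'.continuousAt_symm (ψ'.map_source hy')
  have hval : (fun z => ψ'.symm (A' z)) (A'.symm (ψ' y)) = y := by
    simp [ψ'.left_inv hy']
  have h1 : ∀ᶠ z in 𝓝 (A'.symm (ψ' y)), ψ'.symm (A' z) ∈ U := by
    have hU' : U ∈ 𝓝 ((fun z => ψ'.symm (A' z)) (A'.symm (ψ' y))) := by rwa [hval]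
    exact hc.preimage_mem_nhds hU'
  have h2 : ∀ᶠ z in 𝓝 (A'.symm (ψ' y)), A' z ∈ ψ'.target := by
    have hc2 : ContinuousAt (fun z => A' z) (A'.symm (ψ' y)) := A'.continuous.continuousAt
    refine hc2.preimage_mem_nhds ?_
    rw [ContinuousLinearEquiv.apply_symm_apply]
    exact ψ'.open_target.mem_nhds (ψ'.map_source hy')
  filter_upwards [h1, h2] with z hz1 hz2
  exact ⟨hz1, by rw [ψ'.right_inv hz2, ContinuousLinearEquiv.symm_apply_apply]⟩

/-- **The derivatives of the transition and of the inverse transition are inverse to each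
other**: `D(c' ∘ c⁻¹)(c y) ∘ D(c ∘ c'⁻¹)(c' y) = id`. [folklore] -/
theorem fderiv_transition_comp_eq_id (hψ : ψ ∈ IsManifold.maximalAtlas (𝓡 4) ∞ X)
    (hψ' : ψ' ∈ IsManifold.maximalAtlas (𝓡 4) ∞ X) {y : X} (hy : y ∈ ψ.source)
    (hy' : y ∈ ψ'.source) :
    (fderiv ℝ (fun w => A'.symm (ψ' (ψ.symm (A w)))) (A.symm (ψ y))).comp
        (fderiv ℝ (fun z => A.symm (ψ (ψ'.symm (A' z)))) (A'.symm (ψ' y))) =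
      ContinuousLinearMap.id ℝ _ := by
  set σ : EuclideanSpace ℝ (Fin 4) → EuclideanSpace ℝ (Fin 4) :=
    fun z => A.symm (ψ (ψ'.symm (A' z))) with hσ
  set ρ : EuclideanSpace ℝ (Fin 4) → EuclideanSpace ℝ (Fin 4) :=
    fun w => A'.symm (ψ' (ψ.symm (A w))) with hρ
  have hσd : HasFDerivAt σ (fderiv ℝ σ (A'.symm (ψ' y))) (A'.symm (ψ' y)) :=
    ((contDiffAt_transition hψ hψ' hy hy').differentiableAt (by simp)).hasFDerivAt
  have hσy : σ (A'.symm (ψ' y)) = A.symm (ψ y) := transition_apply_chart hy'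
  have hρd : HasFDerivAt ρ (fderiv ℝ ρ (A.symm (ψ y))) (σ (A'.symm (ψ' y))) := by
    rw [hσy]
    exact ((contDiffAt_transition hψ' hψ hy' hy).differentiableAt (by simp)).hasFDerivAt
  have hcomp : HasFDerivAt (ρ ∘ σ)
      ((fderiv ℝ ρ (A.symm (ψ y))).comp (fderiv ℝ σ (A'.symm (ψ' y)))) (A'.symm (ψ' y)) :=
    hρd.comp _ hσd
  -- `ρ ∘ σ = id` near the point
  have hid : ρ ∘ σ =ᶠ[𝓝 (A'.symm (ψ' y))] id := by
    filter_upwards [eventually_transition (A' := A') hy' (ψ.open_source.mem_nhds hy)]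
      with z hz
    obtain ⟨hz1, hz2⟩ := hz
    simp only [comp_apply, hρ, hσ, id_eq, ContinuousLinearEquiv.apply_symm_apply,
      ψ.left_inv hz1, hz2]
  have hid' : HasFDerivAt (ρ ∘ σ) (ContinuousLinearMap.id ℝ _) (A'.symm (ψ' y)) :=
    (hasFDerivAt_id _).congr_of_eventuallyEq hid
  exact hcomp.unique hid'

/-- **The derivative of the transition is injective** (its left inverse is the derivative of the
inverse transition). [folklore] -/
theorem injective_fderiv_transition (hψ : ψ ∈ IsManifold.maximalAtlas (𝓡 4) ∞ X)
    (hψ' : ψ' ∈ IsManifold.maximalAtlas (𝓡 4) ∞ X) {y : X} (hy : y ∈ ψ.source)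
    (hy' : y ∈ ψ'.source) :
    Injective (fderiv ℝ (fun z => A.symm (ψ (ψ'.symm (A' z)))) (A'.symm (ψ' y))) := by
  have heq := fderiv_transition_comp_eq_id (A := A) (A' := A') hψ hψ' hy hy'
  intro v w hvw
  have := congrArg (fderiv ℝ (fun w => A'.symm (ψ' (ψ.symm (A w)))) (A.symm (ψ y))) hvw
  rw [← ContinuousLinearMap.comp_apply, ← ContinuousLinearMap.comp_apply, heq] at this
  simpa using this

end Transition

/-! ### First-order data of a trisection from the clauses of two linear charts -/

section FirstOrderCharts

variable {X : Type u} [TopologicalSpace X] [ChartedSpace (EuclideanSpace ℝ (Fin 4)) X]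
  {S : Fin 3 → Set X} {i j l : Fin 3}
  {ψ ψ' : OpenPartialHomeomorph X (EuclideanSpace ℝ (Fin 4))}
  {A A' : EuclideanSpace ℝ (Fin 4) ≃L[ℝ] EuclideanSpace ℝ (Fin 4)} {O : Set X}

omit [TopologicalSpace X] [ChartedSpace (EuclideanSpace ℝ (Fin 4)) X] in
/-- Three pairwise distinct indices exhaust `Fin 3`: a point in `S i`, `S j` and `S l` is in
every sector. [folklore] -/
theorem mem_iInter_of_mem_three (hji : j ≠ i) (hli : l ≠ i) (hlj : l ≠ j) {y : X}
    (hyi : y ∈ S i) (hyj : y ∈ S j) (hyl : y ∈ S l) : y ∈ ⋂ m, S m := by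
  simp only [mem_iInter]
  intro m
  have hcases : ∀ i j l m : Fin 3, j = i ∨ l = i ∨ l = j ∨ m = i ∨ m = j ∨ m = l := by decide
  rcases hcases i j l m with h | h | h | rfl | rfl | rfl
  exacts [absurd h hji, absurd h hli, absurd h hlj, hyi, hyj, hyl]

/-- **First-order data of the transition between the linear charts of two adjacent sectors of
a trisection.**  Let `(ψ, A)` be a linear chart of the sector `S i` and `(ψ', A')` one of the
sector `S j ≠ S i` on a common open set `O` (clauses of
`IsGKTrisection.exists_linearChart_face`), normalised so that the common face `S i ∩ S j` is
the face `{q₀ = 0 ≤ q₁}` of both, the other face of `S i` lying in the third sector `S l`.  Then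
at the `c'`-coordinates `p` of every point `y₀ ∈ F ∩ O` the transition
`σ = (A⁻¹ψ) ∘ (A'⁻¹ψ')⁻¹` has a derivative `L` which preserves the stratum plane, satisfies
`(L e₁)₀ = 0 < (L e₁)₁`, and **`(L e₀)₀ < 0`**: the third face `S j ∩ S l` leaves `F` with
negative `q₀`-velocity in the chart of `S i` (`firstOrder_of_cornerTransition`, whose three
hypotheses on `σ` are read off the chart clauses). [cite: GayKirby2016, Def. 1 and Fig. 1]
[cite: Douady1961, §1] -/
theorem firstOrder_of_linearCharts (hji : j ≠ i) (hli : l ≠ i) (hlj : l ≠ j)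
    (hψ : ψ ∈ IsManifold.maximalAtlas (𝓡 4) ∞ X) (hψ' : ψ' ∈ IsManifold.maximalAtlas (𝓡 4) ∞ X)
    (hO : IsOpen O) (hOψ : O ⊆ ψ.source) (hOψ' : O ⊆ ψ'.source)
    (hSi : ∀ y ∈ O, y ∈ S i ↔ A.symm (ψ y) ∈ cornerQuadrant)
    (hFi : ∀ y ∈ O, y ∈ (⋂ m, S m) ↔
      A.symm (ψ y) ∈ cornerQuadrant ∧ A.symm (ψ y) 0 = 0 ∧ A.symm (ψ y) 1 = 0)
    (hOi : ∀ y ∈ O, (∃ m, m ≠ i ∧ y ∈ S m) ↔ ¬ (0 < A.symm (ψ y) 0 ∧ 0 < A.symm (ψ y) 1))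
    (hfi1 : ∀ y ∈ O, A.symm (ψ y) 1 = 0 → 0 < A.symm (ψ y) 0 → y ∈ S l)
    (hSj : ∀ y ∈ O, y ∈ S j ↔ A'.symm (ψ' y) ∈ cornerQuadrant)
    (hFj : ∀ y ∈ O, y ∈ (⋂ m, S m) ↔
      A'.symm (ψ' y) ∈ cornerQuadrant ∧ A'.symm (ψ' y) 0 = 0 ∧ A'.symm (ψ' y) 1 = 0)
    (hOj : ∀ y ∈ O, (∃ m, m ≠ j ∧ y ∈ S m) ↔ ¬ (0 < A'.symm (ψ' y) 0 ∧ 0 < A'.symm (ψ' y) 1))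
    (hfj0 : ∀ y ∈ O, A'.symm (ψ' y) 0 = 0 → 0 < A'.symm (ψ' y) 1 → y ∈ S i)
    {y₀ : X} (hy₀ : y₀ ∈ O) (hy₀F : y₀ ∈ ⋂ m, S m) :
    (∀ w : EuclideanSpace ℝ (Fin 4), w 0 = 0 → w 1 = 0 →
        fderiv ℝ (fun z => A.symm (ψ (ψ'.symm (A' z)))) (A'.symm (ψ' y₀)) w 0 = 0 ∧
        fderiv ℝ (fun z => A.symm (ψ (ψ'.symm (A' z)))) (A'.symm (ψ' y₀)) w 1 = 0) ∧
      fderiv ℝ (fun z => A.symm (ψ (ψ'.symm (A' z)))) (A'.symm (ψ' y₀))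
        (EuclideanSpace.single 1 1) 0 = 0 ∧
      0 < fderiv ℝ (fun z => A.symm (ψ (ψ'.symm (A' z)))) (A'.symm (ψ' y₀))
        (EuclideanSpace.single 1 1) 1 ∧
      fderiv ℝ (fun z => A.symm (ψ (ψ'.symm (A' z)))) (A'.symm (ψ' y₀))
        (EuclideanSpace.single 0 1) 0 < 0 := by
  set σ : EuclideanSpace ℝ (Fin 4) → EuclideanSpace ℝ (Fin 4) :=
    fun z => A.symm (ψ (ψ'.symm (A' z))) with hσdef
  set p := A'.symm (ψ' y₀) with hpdef
  have hp : p 0 = 0 ∧ p 1 = 0 := ((hFj y₀ hy₀).1 hy₀F).2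
  have hσ : HasFDerivAt σ (fderiv ℝ σ p) p :=
    ((contDiffAt_transition hψ hψ' (hOψ hy₀) (hOψ' hy₀)).differentiableAt (by simp)).hasFDerivAt
  have hinj : Injective (fderiv ℝ σ p) :=
    injective_fderiv_transition hψ hψ' (hOψ hy₀) (hOψ' hy₀)
  have hev := eventually_transition (A' := A') (hOψ' hy₀) (hO.mem_nhds hy₀)
  -- the three hypotheses of `firstOrder_of_cornerTransition`, read off the chart clauses
  have hstr : ∀ᶠ z in 𝓝 p, (z 0 = 0 ∧ z 1 = 0) → (σ z 0 = 0 ∧ σ z 1 = 0) := by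
    filter_upwards [hev] with z hz hz01
    obtain ⟨hzO, hzc⟩ := hz
    have hyF : ψ'.symm (A' z) ∈ ⋂ m, S m := by
      refine (hFj _ hzO).2 ?_
      rw [hzc]
      exact ⟨⟨le_of_eq hz01.1.symm, le_of_eq hz01.2.symm⟩, hz01.1, hz01.2⟩
    exact ((hFi _ hzO).1 hyF).2
  have hface : ∀ᶠ z in 𝓝 p, (z 0 = 0 ∧ 0 ≤ z 1) → (σ z 0 = 0 ∧ 0 ≤ σ z 1) := by
    filter_upwards [hev] with z hz hz01
    obtain ⟨hzO, hzc⟩ := hz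
    set y := ψ'.symm (A' z) with hy
    rcases hz01.2.lt_or_eq with h1 | h1
    · -- a point of the open common face
      have hyi : y ∈ S i := hfj0 y hzO (by rw [hzc]; exact hz01.1) (by rwa [hzc])
      have hyj : y ∈ S j := (hSj y hzO).2 (by rw [hzc]; exact ⟨le_of_eq hz01.1.symm, hz01.2⟩)
      have hQ : A.symm (ψ y) ∈ cornerQuadrant := (hSi y hzO).1 hyi
      have hnot : ¬ (0 < A.symm (ψ y) 0 ∧ 0 < A.symm (ψ y) 1) := (hOi y hzO).1 ⟨j, hji, hyj⟩
      refine ⟨?_, hQ.2⟩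
      rcases hQ.1.lt_or_eq with h0 | h0
      · exfalso
        have hc1 : A.symm (ψ y) 1 = 0 := by
          rcases hQ.2.lt_or_eq with h1' | h1'
          · exact absurd ⟨h0, h1'⟩ hnot
          · exact h1'.symm
        have hyl : y ∈ S l := hfi1 y hzO hc1 h0
        have hyF : y ∈ ⋂ m, S m := mem_iInter_of_mem_three hji hli hlj hyi hyj hyl
        have := ((hFi y hzO).1 hyF).2.1
        rw [this] at h0
        exact lt_irrefl _ h0
      · exact h0.symm
    · -- a point of the stratum
      have hyF : y ∈ ⋂ m, S m := by
        refine (hFj _ hzO).2 ?_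
        rw [hzc]
        exact ⟨⟨le_of_eq hz01.1.symm, hz01.2⟩, hz01.1, h1.symm⟩
      obtain ⟨-, h0, h1'⟩ := (hFi _ hzO).1 hyF
      exact ⟨h0, le_of_eq h1'.symm⟩
  have hopen : ∀ᶠ z in 𝓝 p, (0 < z 0 ∧ 0 < z 1) → ¬ (0 ≤ σ z 0 ∧ 0 ≤ σ z 1) := by
    filter_upwards [hev] with z hz hz01 hQ
    obtain ⟨hzO, hzc⟩ := hz
    set y := ψ'.symm (A' z) with hy
    have hno : ¬ ∃ m, m ≠ j ∧ y ∈ S m := by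
      rw [hOj y hzO, not_not, hzc]
      exact hz01
    have hyi : y ∈ S i := (hSi y hzO).2 hQ
    exact hno ⟨i, fun h => hji h.symm, hyi⟩
  exact firstOrder_of_cornerTransition (a := 0) (b := 1) (Or.inl ⟨rfl, rfl⟩) hσ hinj hp hstr
    hface hopen

end FirstOrderCharts

/-! ### Packaging: the third face leaves `F` into the open third quadrant -/

section Package

variable {X : Type u} [TopologicalSpace X] [T2Space X] [ChartedSpace (EuclideanSpace ℝ (Fin 4)) X]
  {g : ℕ} {k : Fin 3 → ℕ} {S : Fin 3 → Set X}

/-- **Linear charts of two adjacent sectors and the first-order structure of the third face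
(Gay–Kirby's Fig. 1 to first order).**  For a Gay–Kirby trisection, a sector `S i` and `x ∈ F`,
there are linear charts `c = A⁻¹ψ` of `S i` and `c' = A'⁻¹ψ'` of a neighbouring sector `S j`
on a common open neighbourhood `O` of `x` (`ψ x = ψ' x = 0`), normalised so that
`S i = {c ∈ Q}`, `S j = {c' ∈ Q}`, `F = ` stratum of both, the common face `S i ∩ S j` is the face
`{q₀ = 0 ≤ q₁}` of both charts and the other faces lie in the third sector `S l`; the transition
`σ = c ∘ c'⁻¹` is `C^∞` at `c' y` for every `y ∈ O`; and at the `c'`-coordinates of every point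
`y ∈ F ∩ O` its derivative `L` is injective, preserves the stratum plane, has
`(L e₁)₀ = 0 < (L e₁)₁`, and **`(L e₀)₀ < 0`, `(L e₀)₁ < 0`**: the third face
`S j ∩ S l = c'⁻¹{z₁ = 0 ≤ z₀}` leaves the central surface into the open third quadrant of the
normal plane of the chart of `S i` (first component by `firstOrder_of_linearCharts` for the pair
`(i, j)`; second component by the same for `(i, l)` in the chart of `S i` with swapped normal
coordinates, transported along the chain rule `σ = (c ∘ c_l⁻¹) ∘ (c_l ∘ c'⁻¹)`,
`normal_apply_neg_of_comp`). [cite: GayKirby2016, Def. 1 and Fig. 1] [cite: Douady1961, §1] -/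
theorem IsGKTrisection.exists_linearCharts_thirdFace (h : IsGKTrisection X g k S) (i : Fin 3)
    {x : X} (hx : x ∈ ⋂ l, S l) :
    ∃ (ψ ψ' : OpenPartialHomeomorph X (EuclideanSpace ℝ (Fin 4)))
      (A A' : EuclideanSpace ℝ (Fin 4) ≃L[ℝ] EuclideanSpace ℝ (Fin 4)) (O : Set X) (j l : Fin 3),
      ψ ∈ IsManifold.maximalAtlas (𝓡 4) ∞ X ∧ ψ' ∈ IsManifold.maximalAtlas (𝓡 4) ∞ X ∧
      IsOpen O ∧ x ∈ O ∧ O ⊆ ψ.source ∧ O ⊆ ψ'.source ∧ ψ x = 0 ∧ ψ' x = 0 ∧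
      j ≠ i ∧ l ≠ i ∧ l ≠ j ∧
      -- the chart of `S i`
      (∀ y ∈ O, y ∈ S i ↔ A.symm (ψ y) ∈ cornerQuadrant) ∧
      (∀ y ∈ O, y ∈ (⋂ m, S m) ↔
        A.symm (ψ y) ∈ cornerQuadrant ∧ A.symm (ψ y) 0 = 0 ∧ A.symm (ψ y) 1 = 0) ∧
      (∀ y ∈ O, (∃ m, m ≠ i ∧ y ∈ S m) ↔ ¬ (0 < A.symm (ψ y) 0 ∧ 0 < A.symm (ψ y) 1)) ∧
      (∀ y ∈ O, A.symm (ψ y) 0 = 0 → 0 < A.symm (ψ y) 1 → y ∈ S j) ∧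
      (∀ y ∈ O, A.symm (ψ y) 1 = 0 → 0 < A.symm (ψ y) 0 → y ∈ S l) ∧
      -- the chart of `S j`
      (∀ y ∈ O, y ∈ S j ↔ A'.symm (ψ' y) ∈ cornerQuadrant) ∧
      (∀ y ∈ O, y ∈ (⋂ m, S m) ↔
        A'.symm (ψ' y) ∈ cornerQuadrant ∧ A'.symm (ψ' y) 0 = 0 ∧ A'.symm (ψ' y) 1 = 0) ∧
      (∀ y ∈ O, (∃ m, m ≠ j ∧ y ∈ S m) ↔ ¬ (0 < A'.symm (ψ' y) 0 ∧ 0 < A'.symm (ψ' y) 1)) ∧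
      (∀ y ∈ O, A'.symm (ψ' y) 0 = 0 → 0 < A'.symm (ψ' y) 1 → y ∈ S i) ∧
      (∀ y ∈ O, A'.symm (ψ' y) 1 = 0 → 0 < A'.symm (ψ' y) 0 → y ∈ S l) ∧
      -- the transition `σ = c ∘ c'⁻¹`
      (∀ y ∈ O, ContDiffAt ℝ ∞ (fun z => A.symm (ψ (ψ'.symm (A' z)))) (A'.symm (ψ' y))) ∧
      (∀ y ∈ O, y ∈ (⋂ m, S m) →
        Injective (fderiv ℝ (fun z => A.symm (ψ (ψ'.symm (A' z)))) (A'.symm (ψ' y))) ∧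
        (∀ w : EuclideanSpace ℝ (Fin 4), w 0 = 0 → w 1 = 0 →
          fderiv ℝ (fun z => A.symm (ψ (ψ'.symm (A' z)))) (A'.symm (ψ' y)) w 0 = 0 ∧
          fderiv ℝ (fun z => A.symm (ψ (ψ'.symm (A' z)))) (A'.symm (ψ' y)) w 1 = 0) ∧
        fderiv ℝ (fun z => A.symm (ψ (ψ'.symm (A' z)))) (A'.symm (ψ' y))
          (EuclideanSpace.single 1 1) 0 = 0 ∧
        0 < fderiv ℝ (fun z => A.symm (ψ (ψ'.symm (A' z)))) (A'.symm (ψ' y))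
          (EuclideanSpace.single 1 1) 1 ∧
        fderiv ℝ (fun z => A.symm (ψ (ψ'.symm (A' z)))) (A'.symm (ψ' y))
          (EuclideanSpace.single 0 1) 0 < 0 ∧
        fderiv ℝ (fun z => A.symm (ψ (ψ'.symm (A' z)))) (A'.symm (ψ' y))
          (EuclideanSpace.single 0 1) 1 < 0) := by
  -- the chart of `S i`
  obtain ⟨ψ, A, O₁, j, l, hψ, hO₁, hxO₁, hO₁ψ, hψ0, hSi, hFi, hOi, hji, hli, hjl, hfi0, hfi1⟩ :=
    h.exists_linearChart_faces i hx
  -- Fin 3 bookkeeping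
  have third : ∀ m : Fin 3, m ≠ i → m ≠ j → m = l := by
    intro m hmi hmj
    have hcases : ∀ i j l m : Fin 3, j = i ∨ l = i ∨ l = j ∨ m = i ∨ m = j ∨ m = l := by decide
    rcases hcases i j l m with h' | h' | h' | h' | h' | h'
    exacts [absurd h' hji, absurd h' hli, absurd h' hjl.symm, absurd h' hmi, absurd h' hmj, h']
  have third' : ∀ m : Fin 3, m ≠ i → m ≠ l → m = j := by
    intro m hmi hml
    have hcases : ∀ i j l m : Fin 3, j = i ∨ l = i ∨ l = j ∨ m = i ∨ m = l ∨ m = j := by decide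
    rcases hcases i j l m with h' | h' | h' | h' | h' | h'
    exacts [absurd h' hji, absurd h' hli, absurd h' hjl.symm, absurd h' hmi, absurd h' hml, h']
  -- the chart of `S j`, with the common face `{z₀ = 0 ≤ z₁}` in `S i`
  obtain ⟨ψ', A', O₂, l', hψ', hO₂, hxO₂, hO₂ψ', hψ'0, hSj, hFj, hOj, hl'j, hl'i, hfj0, hfj1⟩ :=
    h.exists_linearChart_face (i := j) (j := i) hji.symm hx
  obtain rfl : l = l' := (third l' hl'i hl'j).symm
  -- the chart of `S l`, with the face `{z₀ = 0 ≤ z₁}` in `S i`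
  obtain ⟨ψ'', A'', O₃, j', hψ'', hO₃, hxO₃, hO₃ψ'', -, hSl, hFl, hOl, hj'l, hj'i, hfl0, hfl1⟩ :=
    h.exists_linearChart_face (i := l) (j := i) hli.symm hx
  obtain rfl : j = j' := (third' j' hj'i hj'l).symm
  -- the common neighbourhood
  set O := O₁ ∩ O₂ ∩ O₃ with hOdef
  have hO : IsOpen O := (hO₁.inter hO₂).inter hO₃
  have hxO : x ∈ O := ⟨⟨hxO₁, hxO₂⟩, hxO₃⟩
  have h1 : O ⊆ O₁ := fun y hy => hy.1.1
  have h2 : O ⊆ O₂ := fun y hy => hy.1.2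
  have h3 : O ⊆ O₃ := fun y hy => hy.2
  -- the swapped chart of `S i` (common face with `S l` first)
  obtain ⟨hSi', hFi', hOi', hfi0', hfi1'⟩ := linearChart_clauses_swap hSi hFi hOi hfi0 hfi1
  set A₂ := (LinearIsometryEquiv.piLpCongrLeft 2 ℝ ℝ
      (Equiv.swap (0 : Fin 4) 1)).toContinuousLinearEquiv.trans A with hA₂
  refine ⟨ψ, ψ', A, A', O, j, l, hψ, hψ', hO, hxO, h1.trans hO₁ψ, h2.trans hO₂ψ', hψ0, hψ'0,
    hji, hli, hjl.symm,
    fun y hy => hSi y (h1 hy), fun y hy => hFi y (h1 hy), fun y hy => hOi y (h1 hy),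
    fun y hy => hfi0 y (h1 hy), fun y hy => hfi1 y (h1 hy),
    fun y hy => hSj y (h2 hy), fun y hy => hFj y (h2 hy), fun y hy => hOj y (h2 hy),
    fun y hy => hfj0 y (h2 hy), fun y hy => hfj1 y (h2 hy),
    fun y hy => contDiffAt_transition hψ hψ' (hO₁ψ (h1 hy)) (hO₂ψ' (h2 hy)),
    fun y hy hyF => ?_⟩
  -- first order for the pair `(i, j)`
  obtain ⟨hstr', he1_0, he1_1, hν0⟩ := firstOrder_of_linearCharts (S := S) hji hli hjl.symm hψ hψ'
    hO (h1.trans hO₁ψ) (h2.trans hO₂ψ')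
    (fun y hy => hSi y (h1 hy)) (fun y hy => hFi y (h1 hy)) (fun y hy => hOi y (h1 hy))
    (fun y hy => hfi1 y (h1 hy))
    (fun y hy => hSj y (h2 hy)) (fun y hy => hFj y (h2 hy)) (fun y hy => hOj y (h2 hy))
    (fun y hy => hfj0 y (h2 hy)) hy hyF
  -- first order for the pair `(i, l)`, in the swapped chart of `S i`
  obtain ⟨hstr'', -, -, hμ0⟩ := firstOrder_of_linearCharts (S := S) (A := A₂) hli hji hjl hψ hψ''
    hO (h1.trans hO₁ψ) (h3.trans hO₃ψ'')
    (fun y hy => hSi' y (h1 hy)) (fun y hy => hFi' y (h1 hy)) (fun y hy => hOi' y (h1 hy))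
    (fun y hy => hfi1' y (h1 hy))
    (fun y hy => hSl y (h3 hy)) (fun y hy => hFl y (h3 hy)) (fun y hy => hOl y (h3 hy))
    (fun y hy => hfl0 y (h3 hy)) hy hyF
  -- the transitions
  set σ' : EuclideanSpace ℝ (Fin 4) → EuclideanSpace ℝ (Fin 4) :=
    fun z => A.symm (ψ (ψ'.symm (A' z))) with hσ'
  set σ'' : EuclideanSpace ℝ (Fin 4) → EuclideanSpace ℝ (Fin 4) :=
    fun z => A.symm (ψ (ψ''.symm (A'' z))) with hσ''
  set σ₂ : EuclideanSpace ℝ (Fin 4) → EuclideanSpace ℝ (Fin 4) :=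
    fun z => A₂.symm (ψ (ψ''.symm (A'' z))) with hσ₂
  set τ : EuclideanSpace ℝ (Fin 4) → EuclideanSpace ℝ (Fin 4) :=
    fun z => A''.symm (ψ'' (ψ'.symm (A' z))) with hτ
  set p := A'.symm (ψ' y) with hp
  set p'' := A''.symm (ψ'' y) with hp''
  -- `σ₂ = E ∘ σ''` with `E` the coordinate swap read through `A`
  set E : EuclideanSpace ℝ (Fin 4) ≃L[ℝ] EuclideanSpace ℝ (Fin 4) := A.trans A₂.symm with hE
  have hEapply : ∀ (w : EuclideanSpace ℝ (Fin 4)) (k : Fin 4),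
      E w k = w (Equiv.swap (0 : Fin 4) 1 k) := by
    intro w k
    rw [hE, ContinuousLinearEquiv.trans_apply, hA₂, swap_trans_symm_apply,
      ContinuousLinearEquiv.symm_apply_apply]
  have hσ₂E : σ₂ = E ∘ σ'' := by
    funext z
    simp only [hσ₂, hσ'', comp_apply, hE, ContinuousLinearEquiv.trans_apply,
      ContinuousLinearEquiv.apply_symm_apply]
  have hfd₂ : ∀ v (k : Fin 4),
      fderiv ℝ σ₂ p'' v k = fderiv ℝ σ'' p'' v (Equiv.swap (0 : Fin 4) 1 k) := by
    intro v k
    rw [hσ₂E, E.comp_fderiv, ContinuousLinearMap.comp_apply]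
    exact hEapply _ _
  -- stratum invariance and `(L'' e₀)₁ < 0` for `σ''`
  have hstrL'' : ∀ w : EuclideanSpace ℝ (Fin 4), w 0 = 0 → w 1 = 0 →
      fderiv ℝ σ'' p'' w 0 = 0 ∧ fderiv ℝ σ'' p'' w 1 = 0 := by
    intro w hw0 hw1
    obtain ⟨h0, h1'⟩ := hstr'' w hw0 hw1
    rw [hfd₂] at h0 h1'
    simp only [Equiv.swap_apply_left, Equiv.swap_apply_right] at h0 h1'
    exact ⟨h1', h0⟩
  have hν''1 : fderiv ℝ σ'' p'' (EuclideanSpace.single 0 1) 1 < 0 := by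
    rw [hfd₂] at hμ0
    simpa only [Equiv.swap_apply_left] using hμ0
  -- derivatives of `σ'`, `σ''`, `τ`
  have hyψ : y ∈ ψ.source := hO₁ψ (h1 hy)
  have hyψ' : y ∈ ψ'.source := hO₂ψ' (h2 hy)
  have hyψ'' : y ∈ ψ''.source := hO₃ψ'' (h3 hy)
  have hdσ' : HasFDerivAt σ' (fderiv ℝ σ' p) p :=
    ((contDiffAt_transition hψ hψ' hyψ hyψ').differentiableAt (by simp)).hasFDerivAt
  have hdτ : HasFDerivAt τ (fderiv ℝ τ p) p :=
    ((contDiffAt_transition hψ'' hψ' hyψ'' hyψ').differentiableAt (by simp)).hasFDerivAt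
  have hτp : τ p = p'' := transition_apply_chart hyψ'
  have hdσ'' : HasFDerivAt σ'' (fderiv ℝ σ'' p'') (τ p) := by
    rw [hτp]
    exact ((contDiffAt_transition hψ hψ'' hyψ hyψ'').differentiableAt (by simp)).hasFDerivAt
  -- the chain rule `σ' = σ'' ∘ τ` near `p`
  have hev := eventually_transition (A' := A') hyψ' (hO.mem_nhds hy)
  have hcomp : σ' =ᶠ[𝓝 p] σ'' ∘ τ := by
    filter_upwards [hev] with z hz
    obtain ⟨hzO, -⟩ := hz
    simp only [hσ', hσ'', hτ, comp_apply, ContinuousLinearEquiv.apply_symm_apply,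
      ψ''.left_inv (hO₃ψ'' (h3 hzO))]
  -- `p` and `τ p` are stratum points
  have hpstr : p 0 = 0 ∧ p 1 = 0 := ((hFj y (h2 hy)).1 hyF).2
  have hτpstr : τ p 0 = 0 ∧ τ p 1 = 0 := by
    rw [hτp]
    exact ((hFl y (h3 hy)).1 hyF).2
  -- `τ` maps the third face `{z₁ = 0 ≤ z₀}` into `{z₁ = 0 ≤ z₀}`
  have hT : ∀ᶠ z in 𝓝 p, (z 1 = 0 ∧ 0 ≤ z 0) → (τ z 1 = 0 ∧ 0 ≤ τ z 0) := by
    filter_upwards [hev] with z hz hz10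
    obtain ⟨hzO, hzc⟩ := hz
    set y' := ψ'.symm (A' z) with hy'
    have hτz : τ z = A''.symm (ψ'' y') := rfl
    rcases hz10.2.lt_or_eq with h0 | h0
    · -- a point of the open third face: in `S j` and `S l`
      have hyj : y' ∈ S j := (hSj y' (h2 hzO)).2 (by rw [hzc]; exact ⟨hz10.2, le_of_eq hz10.1.symm⟩)
      have hyl : y' ∈ S l := hfj1 y' (h2 hzO) (by rw [hzc]; exact hz10.1) (by rwa [hzc])
      have hQ : A''.symm (ψ'' y') ∈ cornerQuadrant := (hSl y' (h3 hzO)).1 hyl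
      have hnot : ¬ (0 < A''.symm (ψ'' y') 0 ∧ 0 < A''.symm (ψ'' y') 1) :=
        (hOl y' (h3 hzO)).1 ⟨j, hjl, hyj⟩
      rw [hτz]
      refine ⟨?_, hQ.1⟩
      rcases hQ.2.lt_or_eq with h1' | h1'
      · exfalso
        have hc0 : A''.symm (ψ'' y') 0 = 0 := by
          rcases hQ.1.lt_or_eq with h0' | h0'
          · exact absurd ⟨h0', h1'⟩ hnot
          · exact h0'.symm
        have hyi : y' ∈ S i := hfl0 y' (h3 hzO) hc0 h1'
        have hyF : y' ∈ ⋂ m, S m := mem_iInter_of_mem_three hji hli hjl.symm hyi hyj hyl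
        have := ((hFl y' (h3 hzO)).1 hyF).2.2
        rw [this] at h1'
        exact lt_irrefl _ h1'
      · exact h1'.symm
    · -- a point of the stratum
      have hyF : y' ∈ ⋂ m, S m := by
        refine (hFj _ (h2 hzO)).2 ?_
        rw [hzc]
        exact ⟨⟨hz10.2, le_of_eq hz10.1.symm⟩, h0.symm, hz10.1⟩
      rw [hτz]
      obtain ⟨-, h0', h1'⟩ := (hFl _ (h3 hzO)).1 hyF
      exact ⟨h1', le_of_eq h0'.symm⟩
  have hν1 := (normal_apply_neg_of_comp hdτ hdσ'' hdσ' hcomp hpstr hτpstr hT hstrL'' hν0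
    hν''1).2
  exact ⟨injective_fderiv_transition hψ hψ' hyψ hyψ', hstr', he1_0, he1_1, hν0, hν1⟩

end Package







end Literature.Topology.FourManifolds
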